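import Mathlib
import Literature.NumberTheory.Transcendental.KZProductIdeal
import Summits.KontsevichZagierPeriods.KontsevichZagierPeriods.Theorems.InverseLandauTateLiftingIsotropySpaceMeridian
import Summits.KontsevichZagierPeriods.KontsevichZagierPeriods.Theorems.InverseLandauTateLiftingSphereArea
import Summits.KontsevichZagierPeriods.KontsevichZagierPeriods.Theorems.InverseLandauTateLiftingGramInvariant
import Summits.KontsevichZagierPeriods.KontsevichZagierPeriods.Theorems.InverseLandauTateLiftingRotationSector
import Summits.KontsevichZagierPeriods.KontsevichZagierPeriods.Theorems.InverseLandauTateLiftingFubiniReduction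

/-!
# `TateLifting` (stmt-KontsevichZagierPeriods-9129), line `Sketch` — THE SPACE SECTOR
# (the `O(3)` engine of hard-sphere cluster integrals, assembled)

Assembly of stubs 53–55 of the line (`tateLifting_isotropySpace` = HardSphereVirial's `IsotropyFactorisation3` +
the honest reduced configuration representation; `tateLifting_sphereArea`; `tateLifting_gramInvariant`) with the
product structure of the formal period ring (`KZProductIdeal`):

* `space_engine` — **THE SPACE ENGINE**: for every `ℚ`-semialgebraic `σ ⊆ (ℝ³)³` of finite volume invariant under the
  diagonal action of `O(3)` (three points `x₂, x₃, x₄`, the first particle at the origin), the honest reduced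
  configuration representation `m = [τ, ρ²]`, `τ = {(ρ, y₃, y₄) | ρ > 0, ((0,0,ρ), y₃, y₄) ∈ σ} ⊆ ℝ⁷`, exists and
  `[σ, 1] − (4·[disc])·[m] ∈ KZ.relations` — one rule-(2) move along the rational stereographic frame
  `(a, b, ρ, y₃, y₄) ↦ (ρ ω(a,b), M(a,b) y₃, M(a,b) y₄)` (Jacobian `4ρ²/(1+a²+b²)²`), the product structure
  `[ℝ² × τ, 4/(1+a²+b²)² ⊗ ρ²] = [ℝ², 4/(1+a²+b²)²]·[τ, ρ²]`, and the area of the sphere inside the rules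
  `[ℝ², 4/(1+a²+b²)²] ≡ 4·[disc]`;
* `spaceKernel` — **KERNEL TRANSFER with NO transcendence input**: if Conjecture 1 (kernel form) holds on `closure S`,
  it holds on the subgroup generated by the `O(3)`-invariant three-body configuration volumes whose reduced
  configuration representation reduces to `closure S` (the common factor `4π ≠ 0` cancels);
* `kzPeriodConjecture_space` — two such configuration volumes with the same value are KZ-equivalent;
* `TateLifting_spaceSector` — the crux `TateLifting` on this sector.

The inputs `σ` are typically read off the Gram data of the three points (`tateLifting_gramInvariant`: every such set
is `O(3)`-invariant) — all Mayer-diagram configuration sets of route HardSphereVirial (`StarFourSphere`,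
`RingFourSphere`, `DiamondFourSphere`) are of this form. Design: no definitions. References: M. Kontsevich, D. Zagier,
*Periods* (2001), §§1.2, 4.1; L. Santaló, *Integral Geometry and Geometric Probability* (2004), §I.1.
-/

noncomputable section

namespace Summit.KontsevichZagierPeriods.InverseLandau

open MeasureTheory Set
open Literature.NumberTheory.Transcendental
open Literature.ModelTheory.ExponentialFields (IsSemialgebraic)

namespace SpaceSector

/-- The honest stereographic chart representation `[ℝ², 4/(1+a²+b²)²]` of the area of `S²` (integrability by
domination with the integrable product `4·(1+a²)⁻¹(1+b²)⁻¹`). [cite: KontsevichZagier2001, §1.1] -/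
theorem exists_sphereChartRep : ∃ c : KZ.IntegralRep 2, c.domain = Set.univ ∧
    (c.integrand = fun u => 4 / (1 + u 0 ^ 2 + u 1 ^ 2) ^ 2) := by
  have hsa : IsSemialgebraicFunOn ℚ (Set.univ : Set (Fin 2 → ℝ))
      (fun u : Fin 2 → ℝ => 4 / (1 + u 0 ^ 2 + u 1 ^ 2) ^ 2) := by
    refine (isSemialgebraicFunOn_aeval_div_aeval Literature.ModelTheory.ExponentialFields.isSemialgebraic_univ
      (MvPolynomial.C 4 : MvPolynomial (Fin 2) ℚ) ((1 + MvPolynomial.X 0 ^ 2 + MvPolynomial.X 1 ^ 2) ^ 2)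
      fun x _ => ?_).congr fun x _ => ?_
    · simp only [map_add, map_one, map_pow, MvPolynomial.aeval_X]; positivity
    · simp
  have hint : IntegrableOn (fun u : Fin 2 → ℝ => 4 / (1 + u 0 ^ 2 + u 1 ^ 2) ^ 2) Set.univ := by
    rw [integrableOn_univ]
    have hg : Integrable (fun u : Fin 2 → ℝ => ∏ i : Fin 2, (1 + u i ^ 2)⁻¹) :=
      Integrable.fintype_prod (f := fun _ : Fin 2 => fun t : ℝ => (1 + t ^ 2)⁻¹)
        (fun _ => integrable_inv_one_add_sq)
    have hc : Continuous (fun u : Fin 2 → ℝ => 4 / (1 + u 0 ^ 2 + u 1 ^ 2) ^ 2) :=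
      continuous_const.div (by fun_prop) fun u => by positivity
    refine (hg.const_mul 4).mono' hc.aestronglyMeasurable (Filter.Eventually.of_forall fun u => ?_)
    rw [Real.norm_eq_abs, abs_of_nonneg (by positivity), Fin.prod_univ_two]
    have ha : (0 : ℝ) < 1 + u 0 ^ 2 := by positivity
    have hb : (0 : ℝ) < 1 + u 1 ^ 2 := by positivity
    rw [show (4 : ℝ) * ((1 + u 0 ^ 2)⁻¹ * (1 + u 1 ^ 2)⁻¹) = 4 / ((1 + u 0 ^ 2) * (1 + u 1 ^ 2)) by
      field_simp]
    exact div_le_div_of_nonneg_left (by norm_num) (by positivity)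
      (by nlinarith [sq_nonneg (u 0 * u 1), sq_nonneg (u 0), sq_nonneg (u 1)])
  exact ⟨⟨Set.univ, _, Literature.ModelTheory.ExponentialFields.isSemialgebraic_univ, hsa, hint⟩, rfl, rfl⟩

/-- **Space reduction with a given reduced representation**: `[σ, 1] − (4·[disc])·[m] ∈ relations` for every honest
`m` over `τ` with integrand `ρ²` there (the reduced representation of `IsotropyFactorisation3` realised as the honest
product `[ℝ², 4/(1+a²+b²)²] × m`, then `tateLifting_sphereArea`). [cite: KontsevichZagier2001, §4.1] -/
theorem reduce_of_meridian (σ : Set (Fin 9 → ℝ)) (hσ : IsSemialgebraic ℚ σ)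
    (hO : ∀ R : Matrix (Fin 3) (Fin 3) ℝ, R.transpose * R = 1 → ∀ x : Fin 9 → ℝ,
        x ∈ σ ↔ (![(R.mulVec ![x 0, x 1, x 2]) 0, (R.mulVec ![x 0, x 1, x 2]) 1, (R.mulVec ![x 0, x 1, x 2]) 2,
          (R.mulVec ![x 3, x 4, x 5]) 0, (R.mulVec ![x 3, x 4, x 5]) 1, (R.mulVec ![x 3, x 4, x 5]) 2,
          (R.mulVec ![x 6, x 7, x 8]) 0, (R.mulVec ![x 6, x 7, x 8]) 1, (R.mulVec ![x 6, x 7, x 8]) 2] :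
            Fin 9 → ℝ) ∈ σ)
    (r : KZ.IntegralRep 9) (hrd : r.domain = σ) (hri : ∀ x ∈ r.domain, r.integrand x = 1) (m : KZ.IntegralRep 7)
    (hmd : m.domain = {p | 0 < p 0 ∧ (![0, 0, p 0, p 1, p 2, p 3, p 4, p 5, p 6] : Fin 9 → ℝ) ∈ σ})
    (hmi : Set.EqOn m.integrand (fun p => p 0 ^ 2) m.domain) :
    KZ.of r - ((4 : ℤ) • KZ.of KZ.piRep) * KZ.of m ∈ KZ.relations := by
  obtain ⟨c, hcd, hci⟩ := exists_sphereChartRep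
  have hq := tateLifting_isotropySpace.1 σ hσ hO r hrd hri (c.prod m) ?_ ?_
  · have h1 : KZ.of (c.prod m) - KZ.of c * KZ.of m ∈ KZ.relations := by
      rw [← KZ.of_mul_of, sub_self]; exact KZ.relations.zero_mem
    have h2 : KZ.of c * KZ.of m - ((4 : ℤ) • KZ.of KZ.piRep) * KZ.of m ∈ KZ.relations := by
      rw [← sub_mul]; exact KZ.mul_mem_relations_right_holds _ _ (tateLifting_sphereArea c hcd hci)
    have : KZ.of r - ((4 : ℤ) • KZ.of KZ.piRep) * KZ.of m = (KZ.of r - KZ.of (c.prod m)) +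
        (KZ.of (c.prod m) - KZ.of c * KZ.of m) + (KZ.of c * KZ.of m - ((4 : ℤ) • KZ.of KZ.piRep) * KZ.of m) := by
      abel
    rw [this]
    exact KZ.relations.add_mem (KZ.relations.add_mem hq h1) h2
  · rw [KZ.IntegralRep.prod_domain]
    ext w
    simp only [KZ.IntegralRep.mem_prodDomain, hcd, Set.mem_univ, true_and, hmd, Set.mem_setOf_eq]
    rfl
  · intro w hw
    rw [KZ.IntegralRep.prod_integrand_eq, KZ.IntegralRep.prodFun_apply, hci]
    rw [KZ.IntegralRep.prod_domain, KZ.IntegralRep.mem_prodDomain] at hw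
    rw [hmi hw.2]
    rfl

end SpaceSector

open SpaceSector

/-- **THE SPACE ENGINE.** For every `ℚ`-semialgebraic `σ ⊆ (ℝ³)³` invariant under the diagonal action of `O(3)` and
carrying an integrand-`1` representation `r = [σ, 1]` (finite volume), the honest reduced configuration
representation `m = [τ, ρ²]`, `τ = {(ρ, y₃, y₄) | ρ > 0, ((0,0,ρ), y₃, y₄) ∈ σ}`, exists and
`[σ, 1] − (4·[disc])·[m] ∈ KZ.relations`: `⟦σ⟧ = 4π·⟦τ, ρ²⟧` in the formal period ring, inside the rules.
[cite: KontsevichZagier2001, §1.2 rule (2)] -/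
theorem space_engine :
    ∀ (σ : Set (Fin 9 → ℝ)), IsSemialgebraic ℚ σ →
      (∀ R : Matrix (Fin 3) (Fin 3) ℝ, R.transpose * R = 1 → ∀ x : Fin 9 → ℝ, x ∈ σ ↔ (![(R.mulVec ![x 0, x 1, x 2]) 0, (R.mulVec ![x 0, x 1, x 2]) 1, (R.mulVec ![x 0, x 1, x 2]) 2, (R.mulVec ![x 3, x 4, x 5]) 0, (R.mulVec ![x 3, x 4, x 5]) 1, (R.mulVec ![x 3, x 4, x 5]) 2, (R.mulVec ![x 6, x 7, x 8]) 0, (R.mulVec ![x 6, x 7, x 8]) 1, (R.mulVec ![x 6, x 7, x 8]) 2] : Fin 9 → ℝ) ∈ σ) →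
      ∀ (r : KZ.IntegralRep 9), r.domain = σ → (∀ x ∈ r.domain, r.integrand x = 1) →
      ∃ m : KZ.IntegralRep 7,
        m.domain = {p | 0 < p 0 ∧ (![0, 0, p 0, p 1, p 2, p 3, p 4, p 5, p 6] : Fin 9 → ℝ) ∈ σ} ∧
        (m.integrand = fun p => p 0 ^ 2) ∧
        KZ.of r - ((4 : ℤ) • KZ.of KZ.piRep) * KZ.of m ∈ KZ.relations := by
  intro σ hσ hO r hrd hri
  obtain ⟨m, hmd, hmi⟩ := tateLifting_isotropySpace.2 σ hσ hO r hrd hri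
  exact ⟨m, hmd, hmi, reduce_of_meridian σ hσ hO r hrd hri m hmd (fun p _ => by rw [hmi])⟩

/-- **SPACE KERNEL TRANSFER.** Let `S`, `B` be sets of formal combinations such that every element of `B` is the class
of an integrand-`1` representation over a `ℚ`-semialgebraic `σ ⊆ (ℝ³)³` invariant under the diagonal action of `O(3)`,
together with an honest representation `m` over `τ = {(ρ, y₃, y₄) | ρ > 0, ((0,0,ρ), y₃, y₄) ∈ σ}` with integrand `ρ²`
there, which reduces to `closure S` modulo relations. If Conjecture 1 (kernel form) holds on `closure S`, it holds on
`closure B` — with NO transcendence input (the common factor `4π ≠ 0` cancels: `eval` is multiplicative and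
`relations` is an ideal). [cite: KontsevichZagier2001, §1.2] -/
theorem spaceKernel (S B : Set KZ.FormalRep)
    (hB : ∀ d ∈ B, ∃ (σ : Set (Fin 9 → ℝ)) (r : KZ.IntegralRep 9) (m : KZ.IntegralRep 7),
      IsSemialgebraic ℚ σ ∧
      (∀ R : Matrix (Fin 3) (Fin 3) ℝ, R.transpose * R = 1 → ∀ x : Fin 9 → ℝ, x ∈ σ ↔ (![(R.mulVec ![x 0, x 1, x 2]) 0, (R.mulVec ![x 0, x 1, x 2]) 1, (R.mulVec ![x 0, x 1, x 2]) 2, (R.mulVec ![x 3, x 4, x 5]) 0, (R.mulVec ![x 3, x 4, x 5]) 1, (R.mulVec ![x 3, x 4, x 5]) 2, (R.mulVec ![x 6, x 7, x 8]) 0, (R.mulVec ![x 6, x 7, x 8]) 1, (R.mulVec ![x 6, x 7, x 8]) 2] : Fin 9 → ℝ) ∈ σ) ∧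
      r.domain = σ ∧ (∀ x ∈ r.domain, r.integrand x = 1) ∧
      m.domain = {p | 0 < p 0 ∧ (![0, 0, p 0, p 1, p 2, p 3, p 4, p 5, p 6] : Fin 9 → ℝ) ∈ σ} ∧
      Set.EqOn m.integrand (fun p => p 0 ^ 2) m.domain ∧
      (∃ ℓ ∈ AddSubgroup.closure S, KZ.of m - ℓ ∈ KZ.relations) ∧ d = KZ.of r)
    (hK : ∀ c ∈ AddSubgroup.closure S, KZ.eval c = 0 → c ∈ KZ.relations) :
    ∀ c ∈ AddSubgroup.closure B, KZ.eval c = 0 → c ∈ KZ.relations := by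
  refine RotationSector.kernel_of_reduce_mul ((4 : ℤ) • KZ.of KZ.piRep)
    (by rw [map_zsmul, KZ.eval_of_piRep]; exact smul_ne_zero (by norm_num) Real.pi_ne_zero) (fun d hd => ?_) hK
  obtain ⟨σ, r, m, hσ, hO, hrd, hri, hmd, hmi, ⟨ℓ, hℓ, hmℓ⟩, rfl⟩ := hB d hd
  refine ⟨ℓ, hℓ, ?_⟩
  have h0 := reduce_of_meridian σ hσ hO r hrd hri m hmd hmi
  have h1 : ((4 : ℤ) • KZ.of KZ.piRep) * KZ.of m - KZ.of m * ((4 : ℤ) • KZ.of KZ.piRep) ∈ KZ.relations :=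
    KZ.mul_sub_mul_comm_mem_relations _ _
  have h2 : KZ.of m * ((4 : ℤ) • KZ.of KZ.piRep) - ℓ * ((4 : ℤ) • KZ.of KZ.piRep) ∈ KZ.relations := by
    rw [← sub_mul]; exact KZ.mul_mem_relations_right_holds _ _ hmℓ
  have : KZ.of r - ℓ * ((4 : ℤ) • KZ.of KZ.piRep) = (KZ.of r - ((4 : ℤ) • KZ.of KZ.piRep) * KZ.of m) +
      (((4 : ℤ) • KZ.of KZ.piRep) * KZ.of m - KZ.of m * ((4 : ℤ) • KZ.of KZ.piRep)) +
      (KZ.of m * ((4 : ℤ) • KZ.of KZ.piRep) - ℓ * ((4 : ℤ) • KZ.of KZ.piRep)) := by abel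
  rw [this]
  exact KZ.relations.add_mem (KZ.relations.add_mem h0 h1) h2

/-- **Two `O(3)`-invariant three-body configuration volumes whose reduced representations reduce to a common kernel
sector and which have the same value are KZ-equivalent.** [cite: KontsevichZagier2001, §1.2] -/
theorem kzPeriodConjecture_space (S B : Set KZ.FormalRep)
    (hB : ∀ d ∈ B, ∃ (σ : Set (Fin 9 → ℝ)) (r : KZ.IntegralRep 9) (m : KZ.IntegralRep 7),
      IsSemialgebraic ℚ σ ∧
      (∀ R : Matrix (Fin 3) (Fin 3) ℝ, R.transpose * R = 1 → ∀ x : Fin 9 → ℝ, x ∈ σ ↔ (![(R.mulVec ![x 0, x 1, x 2]) 0, (R.mulVec ![x 0, x 1, x 2]) 1, (R.mulVec ![x 0, x 1, x 2]) 2, (R.mulVec ![x 3, x 4, x 5]) 0, (R.mulVec ![x 3, x 4, x 5]) 1, (R.mulVec ![x 3, x 4, x 5]) 2, (R.mulVec ![x 6, x 7, x 8]) 0, (R.mulVec ![x 6, x 7, x 8]) 1, (R.mulVec ![x 6, x 7, x 8]) 2] : Fin 9 → ℝ) ∈ σ) ∧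
      r.domain = σ ∧ (∀ x ∈ r.domain, r.integrand x = 1) ∧
      m.domain = {p | 0 < p 0 ∧ (![0, 0, p 0, p 1, p 2, p 3, p 4, p 5, p 6] : Fin 9 → ℝ) ∈ σ} ∧
      Set.EqOn m.integrand (fun p => p 0 ^ 2) m.domain ∧
      (∃ ℓ ∈ AddSubgroup.closure S, KZ.of m - ℓ ∈ KZ.relations) ∧ d = KZ.of r)
    (hK : ∀ c ∈ AddSubgroup.closure S, KZ.eval c = 0 → c ∈ KZ.relations)
    (r r' : KZ.IntegralRep 9) (hr : KZ.of r ∈ B) (hr' : KZ.of r' ∈ B) (hv : r.value = r'.value) :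
    KZ.Equivalent r r' :=
  Fubini.equivalent_of_kernel (spaceKernel S B hB hK) hr hr' hv

/-- **The crux `TateLifting` on the space images of a kernel sector** (in fact inside `KZ.relations`).
[cite: KontsevichZagier2001, §1.2] -/
theorem TateLifting_spaceSector (S B : Set KZ.FormalRep)
    (hB : ∀ d ∈ B, ∃ (σ : Set (Fin 9 → ℝ)) (r : KZ.IntegralRep 9) (m : KZ.IntegralRep 7),
      IsSemialgebraic ℚ σ ∧
      (∀ R : Matrix (Fin 3) (Fin 3) ℝ, R.transpose * R = 1 → ∀ x : Fin 9 → ℝ, x ∈ σ ↔ (![(R.mulVec ![x 0, x 1, x 2]) 0, (R.mulVec ![x 0, x 1, x 2]) 1, (R.mulVec ![x 0, x 1, x 2]) 2, (R.mulVec ![x 3, x 4, x 5]) 0, (R.mulVec ![x 3, x 4, x 5]) 1, (R.mulVec ![x 3, x 4, x 5]) 2, (R.mulVec ![x 6, x 7, x 8]) 0, (R.mulVec ![x 6, x 7, x 8]) 1, (R.mulVec ![x 6, x 7, x 8]) 2] : Fin 9 → ℝ) ∈ σ) ∧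
      r.domain = σ ∧ (∀ x ∈ r.domain, r.integrand x = 1) ∧
      m.domain = {p | 0 < p 0 ∧ (![0, 0, p 0, p 1, p 2, p 3, p 4, p 5, p 6] : Fin 9 → ℝ) ∈ σ} ∧
      Set.EqOn m.integrand (fun p => p 0 ^ 2) m.domain ∧
      (∃ ℓ ∈ AddSubgroup.closure S, KZ.of m - ℓ ∈ KZ.relations) ∧ d = KZ.of r)
    (hK : ∀ c ∈ AddSubgroup.closure S, KZ.eval c = 0 → c ∈ KZ.relations) (T : Set KZ.FormalRep) :
    ∀ c ∈ AddSubgroup.closure B, KZ.eval c = 0 → c ∈ KZ.relations ⊔ AddSubgroup.closure T :=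
  fun c hc h0 => AddSubgroup.mem_sup_left (spaceKernel S B hB hK c hc h0)

end Summit.KontsevichZagierPeriods.InverseLandau

end
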